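import Mathlib

/-!
# Clause 13-J, brick B5 (band virial): the PHYSICAL-SPACE VIRIAL IDENTITY for an even convolution kernel
# `2Re⟨ i·(k∗Y), (τ−c)·Y ⟩ = i ∫∫ (τ−σ)k(τ−σ) Y(σ) conj Y(τ) dσ dτ`

Route `FilamentSkeletonRss`, child `Clause13NearStraightL` (stmt-NavierStokesRegularity-23321; typing-agnostic, valid verbatim for the
A1G twin 28296); design of record `filament-plan/DESIGN-NOTE-28296-tenure-g22.md` §4 ("the Mourre estimate is a 3-line virial identity
in L², conjugate operator A = τ − c: 2Re⟨DT·Y, (τ−c)Y⟩ = −(Γγ_j/(2πμ))·⟨Y, 𝔖′(μD)Y⟩ + …; [τ, m(D)] = −i m′(D)") and the lane memo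
(g13: "the physical-space virial identity 2⟨J(I−k∗)Y,(τ−c)Y⟩ = −∫∫(τ−σ)k(τ−σ)⟨JY(σ),Y(τ)⟩ is elementary Fubini").  In the complex scalar
model (`J` = multiplication by `i`) and for a real EVEN kernel `k`, with `G(τ,σ) = k(τ−σ)·Y(σ)·conj Y(τ)·(τ−c)` integrable on `ℝ²`:

  `i∫∫G + conj(i∫∫G) = i ∫∫ (τ−σ)·k(τ−σ)·Y(σ)·conj Y(τ)`

(swap the variables in the conjugate term; evenness of `k` turns the weight `(τ−c)` into `(σ−c)`; the difference of the weights is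
`τ−σ` — the commutator `[(τ−c), k∗]` has kernel `(τ−σ)k(τ−σ)`, whose symbol is `i·k̂′`).  The identity term `(2/q)·I` of the model
operator `M_q` drops out (`2Re⟨iY,(τ−c)Y⟩ = 0`, recorded too).  Pure measure theory (Fubini via the measure-preserving swap); the
symbol-side evaluation `−G⟨Y, 𝔖′(μD)Y⟩` is the next brick.
Lane ns-filament-19175-p1 g14; `--supports stmt-NavierStokesRegularity-23321 --as helper`.
HONEST FRAMING: an elementary identity attached to a HYPOTHETICAL filament skeleton's linearised operator on the NEGATIVE side of a
MODEL route; nothing here bears on Navier–Stokes regularity or blow-up.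
-/

noncomputable section

open MeasureTheory Real Complex Filter Set
open scoped ComplexConjugate

namespace Summit.NavierStokesRegularity.NavierStokesRegularity.Theorems.MatchedKernel
set_option linter.dupNamespace false

/-- The identity part drops out of the virial: `i·z + conj(i·z) = 0` for `z = ∫(τ−c)|Y|²` real, pointwise version
`i·((τ−c)·Y·conj Y) + conj(…) = 0`. [folklore] -/
theorem I_mul_real_add_conj (r : ℝ) : I * (r : ℂ) + conj (I * (r : ℂ)) = 0 := by
  rw [map_mul, Complex.conj_I, Complex.conj_ofReal]; ring

/-- **KERNEL VIRIAL IDENTITY (physical space).**  For a real even continuous kernel `k`, a continuous `Y : ℝ → ℂ` and `c : ℝ`, with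
`G(τ,σ) = k(τ−σ)·Y(σ)·conj Y(τ)·(τ−c)` integrable on `ℝ × ℝ`:
`i∫G + conj(i∫G) = i ∫ (τ−σ)k(τ−σ)·Y(σ)·conj Y(τ)` (integrals over `ℝ × ℝ`, `p = (τ, σ)`). [folklore] -/
theorem kernel_virial_identity (k : ℝ → ℝ) (hk : ∀ x, k (-x) = k x) (hkc : Continuous k) (Y : ℝ → ℂ) (hYc : Continuous Y)
    (c : ℝ)
    (hint : Integrable (fun p : ℝ × ℝ => (k (p.1 - p.2) : ℂ) * (Y p.2 * conj (Y p.1)) * ((p.1 - c : ℝ) : ℂ))) :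
    I * (∫ p : ℝ × ℝ, (k (p.1 - p.2) : ℂ) * (Y p.2 * conj (Y p.1)) * ((p.1 - c : ℝ) : ℂ))
      + conj (I * ∫ p : ℝ × ℝ, (k (p.1 - p.2) : ℂ) * (Y p.2 * conj (Y p.1)) * ((p.1 - c : ℝ) : ℂ))
      = I * ∫ p : ℝ × ℝ, (((p.1 - p.2) * k (p.1 - p.2) : ℝ) : ℂ) * (Y p.2 * conj (Y p.1)) := by
  set G₁ : ℝ × ℝ → ℂ := fun p => (k (p.1 - p.2) : ℂ) * (Y p.2 * conj (Y p.1)) * ((p.1 - c : ℝ) : ℂ) with hG₁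
  set G₂ : ℝ × ℝ → ℂ := fun p => (k (p.1 - p.2) : ℂ) * (Y p.2 * conj (Y p.1)) * ((p.2 - c : ℝ) : ℂ) with hG₂
  -- `conj (G₁ (σ, τ)) = G₂ (τ, σ)` (evenness of `k`)
  have hswap : ∀ p : ℝ × ℝ, conj (G₁ p.swap) = G₂ p := by
    intro p
    simp only [hG₁, hG₂, Prod.fst_swap, Prod.snd_swap, map_mul, Complex.conj_ofReal, Complex.conj_conj]
    rw [show p.2 - p.1 = -(p.1 - p.2) by ring, hk]
    ring
  have hG₂c : Continuous G₂ := by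
    simp only [hG₂]
    fun_prop
  -- integrability of `G₂` via the measure-preserving swap
  have hint' : Integrable G₁ ((volume : Measure ℝ).prod volume) := by simpa [Measure.volume_eq_prod] using hint
  have hsw : Integrable (G₁ ∘ Prod.swap) ((volume : Measure ℝ).prod volume) := hint'.swap
  have hint2 : Integrable G₂ (volume : Measure (ℝ × ℝ)) := by
    rw [Measure.volume_eq_prod]
    refine hsw.norm.mono' hG₂c.aestronglyMeasurable (Eventually.of_forall fun p => ?_)
    rw [← hswap p, Complex.norm_conj, Function.comp_apply]
  -- the conjugate term, swapped
  have hconj : conj (∫ p : ℝ × ℝ, G₁ p) = ∫ p : ℝ × ℝ, G₂ p := by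
    rw [← integral_conj]
    have h := integral_prod_swap (μ := (volume : Measure ℝ)) (ν := (volume : Measure ℝ)) (fun p : ℝ × ℝ => conj (G₁ p))
    -- `h : ∫ z, conj (G₁ z.swap) ∂(vol.prod vol) = ∫ z, conj (G₁ z) ∂(vol.prod vol)`
    rw [Measure.volume_eq_prod, ← h]
    exact integral_congr_ae (Eventually.of_forall fun p => hswap p)
  have hI1 : ∫ p : ℝ × ℝ, (k (p.1 - p.2) : ℂ) * (Y p.2 * conj (Y p.1)) * ((p.1 - c : ℝ) : ℂ) = ∫ p, G₁ p := rfl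
  rw [hI1, map_mul, Complex.conj_I, hconj]
  have hpt : ∀ p : ℝ × ℝ, G₁ p - G₂ p = (((p.1 - p.2) * k (p.1 - p.2) : ℝ) : ℂ) * (Y p.2 * conj (Y p.1)) := by
    intro p
    simp only [hG₁, hG₂]
    push_cast
    ring
  calc (I * ∫ p : ℝ × ℝ, G₁ p) + -I * ∫ p : ℝ × ℝ, G₂ p = I * ((∫ p : ℝ × ℝ, G₁ p) - ∫ p : ℝ × ℝ, G₂ p) := by ring
    _ = I * ∫ p : ℝ × ℝ, (G₁ p - G₂ p) := by rw [integral_sub hint hint2]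
    _ = I * ∫ p : ℝ × ℝ, (((p.1 - p.2) * k (p.1 - p.2) : ℝ) : ℂ) * (Y p.2 * conj (Y p.1)) := by
        congr 1
        exact integral_congr_ae (Eventually.of_forall hpt)

end Summit.NavierStokesRegularity.NavierStokesRegularity.Theorems.MatchedKernel

end
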